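import Literature.AnabelianGeometry.EtaleTheta.BiKummerThm44SubRoots
import Literature.AnabelianGeometry.EtaleTheta.BiKummerSettingUnitsKer
import HarnessLib

/-!
# [EtTh] Thm 4.4 (iii) / [FrdII] Def 2.2: `Ψ` on `O^×(−)` along `B″ ≅ Ψ(A″)` — the `isoC`/`isoO` fields

S. Mochizuki, *The étale theta function …* [MochizukiEtTh2009], Thm 4.4 p.94–95 («the isomorphisms `Aut_{C₁}(B₁) ≅
Aut_{C₂}(B₂)`», «Ψ preserves `O^×(−)`»); *The geometry of Frobenioids II* [MochizukiFrdII2008], Def 2.2 (i) p.17, Thm 2.4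
(i) p.19 («Ψ preserves `O^⊳(−)`»).

abc-iut-w6-d047, T44-L15b E-part §2: for `h : Thm44Hyp S₁ S₂` and `e : Ψ(A″) ≅ B″`, the group isomorphism
`isoC := e⁻¹ ∘ Ψ(−) ∘ e : Aut_{C₁}(A″) ⥲ Aut_{C₂}(B″)` restricts to `isoO : O^×(A″) ⥲ O^×(B″)` (abc-iut-L2-t9's
`Thm44Hyp.units_map` + abc-iut-w6-d047's `units_map_conjAut`) — the fields `isoC`, `isoO` of the [FrdII] Def 2.2
context isomorphism, as an existence statement with the values pinned.  Proof-only.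
-/

namespace Literature.AnabelianGeometry.EtaleTheta

open CategoryTheory Opposite Literature.AlgebraicGeometry.Frobenioids

namespace BiKummerSetting

universe u₀ v₀ u v w

variable {K : Type u₀} [Field K] {K' : Type u₀} [Field K'] {D₀ : Type u₀} [Category.{v₀} D₀]
  {X₁ : SemiGraphs.TemperedArithmeticGroup.{u₀} K} {X₂ : SemiGraphs.TemperedArithmeticGroup.{u₀} K'}
  {D₀' : Type u₀} [Category.{v₀} D₀'] {V : FrdIMonoidStub.{w}}
  {T₁ : RealifiedDivisorMonoids (D₀ := D₀) V} {T₂ : RealifiedDivisorMonoids (D₀ := D₀') V}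
  {D₁ D₂ : Type u} [Category.{v} D₁] [Category.{v} D₂] {VD₁ : FrdICatStub.{u, v, w} D₁}
  {VD₂ : FrdICatStub.{u, v, w} D₂} {S₁ : BiKummerSetting X₁ T₁ D₁ VD₁} {S₂ : BiKummerSetting X₂ T₂ D₂ VD₂}

/-- **`isoC := e⁻¹ ∘ Ψ(−) ∘ e` carries `O^×(A″)` ONTO `O^×(B″)`** for `e : Ψ(A″) ≅ B″` («Ψ preserves `O^×(−)`»,
`Thm44Hyp.units_map`, then conjugation along `e`, `units_map_conjAut`). [cite: MochizukiEtTh2009, Thm 4.4 p.95] -/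
theorem Thm44Hyp.units_map_conjAut_comp_mapAut (h : Thm44Hyp S₁ S₂) {A : S₁.C} {B : S₂.C}
    (e : h.Ψ.functor.obj A ≅ B) :
    (S₁.units A).map ((Iso.conjAut e).toMonoidHom.comp (h.Ψ.functor.mapAut A)) = S₂.units B := by
  rw [← Subgroup.map_map, h.units_map]
  exact S₂.tf.units_map_conjAut e

/-- `isoC := e⁻¹ ∘ Ψ(−) ∘ e : Aut_{C₁}(A″) → Aut_{C₂}(B″)` is injective (`Ψ` is faithful, conjugation is bijective).
[cite: MochizukiEtTh2009, Thm 4.4 p.94] -/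
theorem Thm44Hyp.conjAut_comp_mapAut_injective (h : Thm44Hyp S₁ S₂) {A : S₁.C} {B : S₂.C}
    (e : h.Ψ.functor.obj A ≅ B) :
    Function.Injective ((Iso.conjAut e).toMonoidHom.comp (h.Ψ.functor.mapAut A)) :=
  (Iso.conjAut e).injective.comp fun _ _ hab => (h.Ψ.fullyFaithfulFunctor.autMulEquivOfFullyFaithful A).injective hab

/-- **The `isoC`/`isoO` fields of the [FrdII] Def 2.2 context isomorphism induced by `Ψ` along `e : Ψ(A″) ≅ B″`**:
there is a group isomorphism `isoO : O^×(A″) ⥲ O^×(B″)` whose values in `Aut_{C₂}(B″)` are `e⁻¹ ∘ Ψ(u) ∘ e` — the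
restriction of `isoC := e⁻¹ ∘ Ψ(−) ∘ e` (so `isoO` and `isoC` commute with the inclusions `O^× ⊆ Aut`, whence the
`res_isoC`-compatible equivariance for the conjugation actions `actC`). [cite: MochizukiFrdII2008, Thm 2.4 (i) p.19] -/
theorem Thm44Hyp.exists_unitsEquiv (h : Thm44Hyp S₁ S₂) {A : S₁.C} {B : S₂.C} (e : h.Ψ.functor.obj A ≅ B) :
    ∃ isoO : ↥(S₁.units A) ≃* ↥(S₂.units B),
      ∀ u : ↥(S₁.units A), (isoO u : Aut B) = e.conjAut (h.Ψ.functor.mapAut A u) := by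
  refine ⟨((S₁.units A).equivMapOfInjective _ (h.conjAut_comp_mapAut_injective e)).trans
    (MulEquiv.subgroupCongr (h.units_map_conjAut_comp_mapAut e)), fun u => ?_⟩
  rfl

end BiKummerSetting

end Literature.AnabelianGeometry.EtaleTheta
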